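import Summits.QuantumFields.YangMills.Theorems.BalabanUVNodesN06Delta2AtPinsC2Phys
import Literature.MathematicalPhysics.QuantumFieldTheory.Balaban1983to89.B9Eq3136HstarJBound
import Literature.MathematicalPhysics.QuantumFieldTheory.Balaban1983to89.B9Ineq349SiteFromBlocks

/-!
# BalabanUVNodes ∕ N06 ([B9], `Dag.B9_main`) — THE `(H\*J)` LETTER `hHJ` OF THE STAGE-11 CERTIFICATE's (3.137) ROAD AT THE PINS, AS A THEOREM: print p. 422
# «From the regularity condition (3.36) and the inequality (3.133) we have the estimate |(H\*J)(b)| ≦ O(1)Mα₀(Lʲη)⁻³» from a TRANSPOSE-MAJORANT letter for the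
# H-model `HcoK` ((3.133)'s content, column form) + r06's bond-local `RegularAt` at every fine bond (the W-b road's output shape) + the member facts

Track A of `YM-PLAN.md` (cell `pub-ymgap`, HUMAN RULING D-0062), node **N06** = [Balaban1985BackgroundPropagators] Thms 3.1–3.15; WIDTH-209, seat
`pub-ymgap-dag-n06-w8` (g2′), 2026-08-28; the LOCATED-(B′) line of seat g2 (cell bus I.34857) typed.  A HELPER for the stage-11 certificate editions ≥ 30
(`…N06AtOpsYNuOfRecordV6EPairNK`, binder `hD2sup` l.192) and for this seat's F6 `…N06Delta2AtPinsC2Phys` (`hD2sup_of_form_schemas_w`, binder `hHJ`).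
WHAT.  F6 derives edition 30's `hD2sup` (print's (3.137) for def-Y's GENUINE residual `𝔯 := resYOfC2 N θ M⋆ 𝔠`) from [5] (149) (`hC2`) and the DISPLAYED
`(H\*J)` letter `hHJ : ‖(H(U)†J(U))(c)‖ ≦ t_{HJ}·(M_xα₀)·w_H(c)` (`H = HDY … (GpY …)`, `J = JY`, `† = trAdjY`).  THIS FILE proves `hHJ` at the pins, at the weight
`w_H(c) = (Lʲη)_c⁻³` print names, from:
* `hHT` — the TRANSPOSE-MAJORANT LETTER (DISPLAYED): in the regime, n06-d's scaled coordinate model `HcoK x.toKIdx (trBasis N) 𝔅_x id (HDY …) U` of `H(U)` has a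
  counting-transpose `𝔗 x U` (a displayed model family) with the [4]-(2.51) majorant `B_T·e^{−δ_T d(c, y′)}` from the fine carrier (blocks `bI x ∘ fst` =
  `blkBK`) to the coarse one (blocks `fst` = `blkHK`) — (3.133)'s content in COLUMN form (the fine sum over a block of `|H(x, b)|`, which print pays with the
  `η^d` of the weighted scalar product); the certificate derives its `Hm`-majorant from `LettersHZ` and its transposes from def-Y's dictionary
  (`B9CoReadingCoordsTranspose`, `Node00/OpsYDirTranspose`) — the knit's pen, not asserted here;
* `hreg` — REGULARITY AT EVERY FINE BOND (DISPLAYED): in the regime, r06's bond-local datum `RegularAt (shiftsV1 …) U η (c_J·M_xα₀) (len (bI x ⟨s, 0⟩)) μ s`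
  of (3.35)–(3.36) at the scale of the block the bond's source is pinned to — the cube covering of every fine bond by a class cube (`cubeClass396` has no
  level-0 cube: the located W-b gap; def-Y's road), not asserted here; `c_J·a ≦ 1` keeps print's `O(1)Mα₀ ≦ 1`;
* the pin `hbI0` (direction-blind `bI`, the certificate's l.80) and the member facts `q : PinPrims` (p. 398 transfer of `(Lʲη)⁻³` at rate `α_F(1−2α)δ₀`,
  [4] (2.61) row sum at rate `ρ_R`, above ONE threshold each), `δ_T ≧ α_F(1−2α)δ₀ + ρ_R`, and ONE displayed constant
  `t_{HJ} ≧ N·𝔟²·(10⁴(d+1)c_J)·((d+1)·#κ·B_T)·(ℓ+1)³·rowConst261 geo9Y ρ_R` (`κ = TrIdx N`).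
★★ `hHJ_of_transpose_schemas` — output: `∃ M_H`, and above it F6's binder `hHJ` VERBATIM at `w_H x c := ((Lʲη)_c³)⁻¹` (engine: F7
`B9Eq3136HstarJBound.norm_trAdjY_JY_le_of_transposePair_regularAt`).
★★ `hD2sup_of_transpose_schemas` ∕ `hD2L2_of_transpose_schemas` — F6 ∘ this: edition 30's `hD2sup` ∕ edition 29's `hD2L2` at `𝔯 := resYOfC2 N θ M⋆ 𝔠` from
`hC2` (at a weight `w_C` with `w_C(c)·(Lʲη)_c⁻³ ≦ (Lʲη)_c⁻²`, e.g. `w_C = (Lʲη)^{+1}`) + `hHT` + `hreg` (+ def-Y's reality letters `hC hH` for the L² form) —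
the `hHJ` letter ELIMINATED.
KNIT RECIPE (n06-d, editions ≥ 31, optional): `obtain ⟨ML₂, hD2L2⟩ := hD2L2_of_transpose_schemas q hq H 𝔠 𝔬12 bI hbI0 hblk12 𝔗 wC hwC hww κC δC cJ BT δT ρR
tHJ δ₂ θ₂ M a … hC2 hHT hreg hC hH`; thresholds fold by one more `max`.
UNITS NOTE (read, not acted on): def-Y's `resYOfC2` builds `Δ⁽²⁾` with `HDY … (GpY …)` (the v4 `H`, `covLettersY_v4_H`) while the certificate's `(𝔬12 x).Hm U`
pins `(lettersYOfRecordV4P …).H = HDY … (GpPhysY …)` (`Node00.OpsYRecordV4P`: «an instantiated residual at GpPhysY is a later sibling»); F7 is generic in the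
H-letter, this file pins `GpY` to match F6 — a `GpPhysY` twin is one `Gp :=` away when that sibling lands.
HONEST FRAMING.  Kernel bookkeeping over r06's (3.36) theorem (`B9Eq336CurrentBound.norm_J_le_blocks` BY NAME) and [4] (2.51)∕(2.60)∕(2.61); COUNT-NEUTRAL;
(3.133) (as `hHT`) and the cube covering (as `hreg`) stay DISPLAYED letters about the genuine objects; [5]'s `C⁽²⁾` stays the external letter `𝔠` with its
displayed size `hC2`; N06 NOT discharged; K1⁷∕K1⁸ NOT closed.  One finite 𝕋⁴ programme at fixed `ε` — NOT continuum, NOT OS, NOT the mass gap ∕ Clay.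
0 `def`, 0 `sorry`.
-/

noncomputable section

namespace Summit.QuantumFields.YangMills.BalabanUVNodes.N06HstarJAtPinsPhys

open Literature.MathematicalPhysics.QuantumFieldTheory.Balaban1983to89
open Literature.MathematicalPhysics.QuantumFieldTheory.Balaban1983to89.Node00 (CfgY FBondY IBondY GpY parSymY parBY trDualMatY trAdjY JY Stage3Params C2Y
  resYOfC2 etaBY etaS)
open Literature.MathematicalPhysics.QuantumFieldTheory.Balaban1983to89.B9Eq3132SectDLetters (HDY)
open Literature.MathematicalPhysics.QuantumFieldTheory.Balaban1983to89.B9Thm34Ext (toB6)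
open Literature.MathematicalPhysics.QuantumFieldTheory.Balaban1983to89.B6RandomWalk (HasMajorant)
open Literature.MathematicalPhysics.QuantumFieldTheory.Balaban1983to89.B6RandomWalkHom (HasMajorantHom)
open Literature.MathematicalPhysics.QuantumFieldTheory.Balaban1983to89.B9SectDL2Decay (BlockBd)
open Literature.MathematicalPhysics.QuantumFieldTheory.Balaban1983to89.B9Thm37Glue (IsTransposePair)
open Literature.MathematicalPhysics.QuantumFieldTheory.Balaban1983to89.B9Thm312Whole (GeoOK)
open Literature.MathematicalPhysics.QuantumFieldTheory.Balaban1983to89.B9RWSums343to347Whole (Facts347)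
open Literature.MathematicalPhysics.QuantumFieldTheory.Balaban1983to89.B9RWSumsDefinitePins (PinPrims)
open Literature.MathematicalPhysics.QuantumFieldTheory.Balaban1983to89.B9RWSums347DefiniteFaces (exp261 lemma21Pack_geo9Y)
open Literature.MathematicalPhysics.QuantumFieldTheory.Balaban1983to89.B9RowSum261DefiniteFaces (rowConst261 rowConst261_nonneg rowConst261_spec_of_rowSum261)
open Literature.MathematicalPhysics.QuantumFieldTheory.Balaban1983to89.B9RWSums346Schur (scaleTransfer_len_rpow)
open Literature.MathematicalPhysics.QuantumFieldTheory.Balaban1983to89.B9PinMembersKLevelV1 (MemberY geo9Y bg9Y)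
open Literature.MathematicalPhysics.QuantumFieldTheory.Balaban1983to89.B9PinGeometryKLevelV1 (c35Y)
open Literature.MathematicalPhysics.QuantumFieldTheory.Balaban1983to89.B9GeoLemma21KLevelV1 (geo9Y_len_pos geo9Y_dist_triangle geo9Y_dist_comm rowSum261_geo9Y)
open Literature.MathematicalPhysics.QuantumFieldTheory.Balaban1983to89.B9GeoNormsKLevelV1 (geo9K_dist_nonneg)
open Literature.MathematicalPhysics.QuantumFieldTheory.Balaban1983to89.B7Prop2SpecialUnitary (specialUnitaryUnits specialUnitaryUnits_le_unitaryUnits)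
open Literature.MathematicalPhysics.QuantumFieldTheory.Balaban1983to89.B9CoReadingCoords (XBK blkBK)
open Literature.MathematicalPhysics.QuantumFieldTheory.Balaban1983to89.B9CoReadingCoordsH (XHK HcoK)
open Literature.MathematicalPhysics.QuantumFieldTheory.Balaban1983to89.B9CoReadingCoordsS (XSK)
open Literature.MathematicalPhysics.QuantumFieldTheory.Balaban1983to89.B9CoReadingCoordsTranspose (TrIdx trBasis)
open Literature.MathematicalPhysics.QuantumFieldTheory.Balaban1983to89.B9Thm39ReadingCoords (cR39 basisBound39)
open Literature.MathematicalPhysics.QuantumFieldTheory.Balaban1983to89.Node00.OpsYSectDCoords (cR39_trBasis_pos)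
open Literature.MathematicalPhysics.QuantumFieldTheory.Balaban1983to89.B9PerturbationL2Delta2 (D2coK)
open Literature.MathematicalPhysics.QuantumFieldTheory.Balaban1983to89.B9Delta2FormMajorant (C2FormMaj)
open Literature.MathematicalPhysics.QuantumFieldTheory.Balaban1983to89.B9Eq336CurrentBound (RegularAt)
open Literature.MathematicalPhysics.QuantumFieldTheory.Balaban1983to89.B9BackgroundsKLevelV1 (shiftsV1)
open Literature.MathematicalPhysics.QuantumFieldTheory.Balaban1983to89.B6GlobalChartV1 (PV)
open Literature.MathematicalPhysics.QuantumFieldTheory.Balaban1983to89.B6Ineq2142KLevelV1 (β)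
open Literature.MathematicalPhysics.QuantumFieldTheory.Balaban1983to89.B9Ineq349SiteComposite (lenB lenB_eq etaS_pos)
open Literature.MathematicalPhysics.QuantumFieldTheory.Balaban1983to89.B9Ineq349SiteFromBlocks (geo9Y_len_eq_lenB etaS_eq_abs_cf_inv)
open Literature.MathematicalPhysics.QuantumFieldTheory.Balaban1983to89.B9Eq3136HstarJBound (norm_trAdjY_JY_le_of_transposePair_regularAt)
open Summit.QuantumFields.YangMills.BalabanUVNodes.N06Delta2AtPinsC2Phys (hD2sup_of_form_schemas_w hD2L2_of_form_schemas_w)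
open scoped Matrix.Norms.L2Operator

variable {N : ℕ} [NeZero N] {θ : Stage3Params} {Mstar : ℕ}
variable [∀ x : MemberY θ.d₆ θ.ℓ₆ θ.hd' θ.hL' θ.b₀ θ.b₁ Mstar, Fintype (geo9Y x).Site]

omit [∀ x : MemberY θ.d₆ θ.ℓ₆ θ.hd' θ.hL' θ.b₀ θ.b₁ Mstar, Fintype (geo9Y x).Site] in
/-- every block scale of the record geometry is at least the lattice spacing: `η = |c_f|⁻¹ ≦ L^{j(b)}·η = (geo9Y x).len b`.
[cite: Balaban1985BackgroundPropagators, (3.41) p.397 («Lʲη»), p.389 (T_η), bookkeeping] -/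
theorem etaBY_le_len (x : MemberY θ.d₆ θ.ℓ₆ θ.hd' θ.hL' θ.b₀ θ.b₁ Mstar) (b : (geo9Y x).Site) : etaBY x.toKIdx ≤ (geo9Y x).len b := by
  rw [geo9Y_len_eq_lenB, lenB_eq]
  have hη : etaBY x.toKIdx = etaS x.toKIdx := by rw [etaS_eq_abs_cf_inv]; rfl
  rw [hη]
  have h1 : (1 : ℝ) ≤ ((θ.ℓ₆ : ℝ) + 1) ^ (β x.hN x.D x.hk b).1.1 := one_le_pow₀ (by linarith [(Nat.cast_nonneg θ.ℓ₆ : (0 : ℝ) ≤ θ.ℓ₆)])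
  have hη0 : 0 < etaS x.toKIdx := etaS_pos _
  nlinarith

/-- ★★ **F6's `(H\*J)` LETTER `hHJ` AT THE PINS, FROM THE TRANSPOSE-MAJORANT LETTER + REGULARITY AT EVERY FINE BOND + MEMBER FACTS** (module docstring):
in the regime and above ONE threshold, `‖(H(U)†J(U))(c)‖ ≦ t_{HJ}·(M_xα₀)·((Lʲη)_c³)⁻¹` for def-Y's `H(U) = HDY x.toKIdx parSymY parBY (GpY parSymY) U` and
`J(U) = JY x.toKIdx U` — F6's binder `hHJ` VERBATIM at the weight family `w_H x c := ((geo9Y x).len c ^ 3)⁻¹`.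
[cite: Balaban1985BackgroundPropagators, p.422 (the sentence between (3.136) and (3.137)), (3.133) p.422, (3.36) p.396, (3.126) p.420, p.398; Balaban1984PropagatorsII, (2.51) p.232, Lemma 2.1 (2.60)–(2.61) pp.233–234] -/
theorem hHJ_of_transpose_schemas (q : PinPrims) (hq : q.OK) (H : MemberY θ.d₆ θ.ℓ₆ θ.hd' θ.hL' θ.b₀ θ.b₁ Mstar → Prop)
    (bI : ∀ x : MemberY θ.d₆ θ.ℓ₆ θ.hd' θ.hL' θ.b₀ θ.b₁ Mstar, FBondY x.toKIdx → IBondY x.toKIdx)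
    (hbI0 : ∀ (x : MemberY θ.d₆ θ.ℓ₆ θ.hd' θ.hL' θ.b₀ θ.b₁ Mstar) (f : FBondY x.toKIdx), bI x f = bI x ⟨f.src, 0⟩)
    (𝔗 : ∀ x : MemberY θ.d₆ θ.ℓ₆ θ.hd' θ.hL' θ.b₀ θ.b₁ Mstar, (bg9Y (Matrix (Fin N) (Fin N) ℂ) (specialUnitaryUnits (Fin N)) x).Cfg →
      (XBK (TrIdx N) x.toKIdx → ℝ) →ₗ[ℝ] (XHK (TrIdx N) x.toKIdx → ℝ))
    (cJ BT δT ρR tHJ M a : ℝ) (hcJ : 0 ≤ cJ) (hBT : 0 ≤ BT) (hρR : 0 < ρR) (hM : 0 < M) (ha1 : cJ * a ≤ 1)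
    (hδT : q.αF * ((1 - 2 * q.α) * q.δ₀) + ρR ≤ δT)
    (htHJ : N * basisBound39 (trBasis N) ^ 2 * (10 ^ 4 * ((θ.d₆ : ℝ) + 1) * cJ) * (((θ.d₆ : ℝ) + 1) * Fintype.card (TrIdx N) * BT) *
      ((((θ.ℓ₆ + 1 : ℕ) : ℝ) ^ 3) * rowConst261 (geo9Y (d := θ.d₆) (ℓ := θ.ℓ₆) (hd := θ.hd') (hL := θ.hL') (b₀ := θ.b₀) (b₁ := θ.b₁) (Mstar := Mstar)) ρR) ≤ tHJ)
    (hHT : ∀ x : MemberY θ.d₆ θ.ℓ₆ θ.hd' θ.hL' θ.b₀ θ.b₁ Mstar, M ≤ (geo9Y x).M → ∀ α₀ : ℝ, 0 < α₀ → (geo9Y x).M * α₀ ≤ a →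
      ∀ U : (bg9Y (Matrix (Fin N) (Fin N) ℂ) (specialUnitaryUnits (Fin N)) x).Cfg,
        (bg9Y (Matrix (Fin N) (Fin N) ℂ) (specialUnitaryUnits (Fin N)) x).Reg335 c35Y α₀ U →
        (bg9Y (Matrix (Fin N) (Fin N) ℂ) (specialUnitaryUnits (Fin N)) x).Reg336 c35Y α₀ U →
          IsTransposePair (HcoK x.toKIdx (trBasis N) (bg9Y (Matrix (Fin N) (Fin N) ℂ) (specialUnitaryUnits (Fin N)) x) (fun U => U)
              (HDY x.toKIdx (parSymY x.toKIdx) (parBY x.toKIdx) (GpY x.toKIdx (parSymY x.toKIdx))) U) (𝔗 x U) ∧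
            HasMajorantHom (g := toB6 (geo9Y x) 1 (H x)) (fun p : XBK (TrIdx N) x.toKIdx => bI x p.1) (fun p : XHK (TrIdx N) x.toKIdx => p.1) (𝔗 x U)
              (fun c y' => BT * Real.exp (-(δT * (geo9Y x).dist c y'))))
    (hreg : ∀ x : MemberY θ.d₆ θ.ℓ₆ θ.hd' θ.hL' θ.b₀ θ.b₁ Mstar, M ≤ (geo9Y x).M → ∀ α₀ : ℝ, 0 < α₀ → (geo9Y x).M * α₀ ≤ a →
      ∀ U : (bg9Y (Matrix (Fin N) (Fin N) ℂ) (specialUnitaryUnits (Fin N)) x).Cfg,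
        (bg9Y (Matrix (Fin N) (Fin N) ℂ) (specialUnitaryUnits (Fin N)) x).Reg335 c35Y α₀ U →
        (bg9Y (Matrix (Fin N) (Fin N) ℂ) (specialUnitaryUnits (Fin N)) x).Reg336 c35Y α₀ U →
          ∀ μ s, RegularAt (shiftsV1 (PV θ.d₆ θ.ℓ₆ x.toKIdx.m x.toKIdx.K θ.hd' θ.hL')) U (etaBY x.toKIdx)
            (cJ * ((geo9Y x).M * α₀)) ((geo9Y x).len (bI x ⟨s, 0⟩)) μ s) :
    ∃ MH : ℝ, ∀ x : MemberY θ.d₆ θ.ℓ₆ θ.hd' θ.hL' θ.b₀ θ.b₁ Mstar, MH ≤ (geo9Y x).M → M ≤ (geo9Y x).M → ∀ α₀ : ℝ, 0 < α₀ → (geo9Y x).M * α₀ ≤ a →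
      ∀ U : (bg9Y (Matrix (Fin N) (Fin N) ℂ) (specialUnitaryUnits (Fin N)) x).Cfg,
        (bg9Y (Matrix (Fin N) (Fin N) ℂ) (specialUnitaryUnits (Fin N)) x).Reg335 c35Y α₀ U →
        (bg9Y (Matrix (Fin N) (Fin N) ℂ) (specialUnitaryUnits (Fin N)) x).Reg336 c35Y α₀ U →
          ∀ c : IBondY x.toKIdx,
            ‖trAdjY (trDualMatY N) (HDY x.toKIdx (parSymY x.toKIdx) (parBY x.toKIdx) (GpY x.toKIdx (parSymY x.toKIdx)) U) (JY x.toKIdx U) c‖ ≤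
              tHJ * ((geo9Y x).M * α₀) * ((geo9Y x).len c ^ 3)⁻¹ := by
  -- member facts: the p. 398 transfer at ((1 − 2α)δ₀, α_F) and [4] (2.61) at the rate ρ_R, above ONE threshold each
  obtain ⟨Mth, -, hfacts, -⟩ :=
    lemma21Pack_geo9Y (d := θ.d₆) (ℓ := θ.ℓ₆) (hd := θ.hd') (hL := θ.hL') (b₀ := θ.b₀) (b₁ := θ.b₁) (Mstar := Mstar) H hq.α_pos hq.α_lt
      hq.δ₀_pos hq.αF_pos (by linarith only [hq.αF_lt])
  obtain ⟨MLσ, hrowc⟩ := rowConst261_spec_of_rowSum261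
    (rowSum261_geo9Y (d := θ.d₆) (ℓ := θ.ℓ₆) (hd := θ.hd') (hL := θ.hL') (b₀ := θ.b₀) (b₁ := θ.b₁) (Mstar := Mstar)) hρR
  have hN : 0 < N := Nat.pos_of_ne_zero (NeZero.ne N)
  have hc0 : 0 < cR39 (trBasis N) := cR39_trBasis_pos hN
  refine ⟨max Mth MLσ, fun x hMx hMM α₀ hα ha U hU hU' c => ?_⟩
  have hF := hfacts x ((le_max_left _ _).trans hMx)
  have hθ : 0 ≤ (geo9Y x).M * α₀ := mul_nonneg (hM.le.trans hMM) hα.le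
  -- print's `O(1)Mα₀ ≤ 1`
  have hC0 : 0 ≤ cJ * ((geo9Y x).M * α₀) := mul_nonneg hcJ hθ
  have hC1 : cJ * ((geo9Y x).M * α₀) ≤ 1 := (mul_le_mul_of_nonneg_left ha hcJ).trans ha1
  -- p. 398 transfer of `(Lʲη)⁻³` at constant `L³ ≤ (ℓ+1)³`
  have hL1 : 1 ≤ (geo9Y x).L := hF.one_le_L
  have hLle : (geo9Y x).L ^ |(-3 : ℝ)| ≤ ((θ.ℓ₆ + 1 : ℕ) : ℝ) ^ 3 := by
    rw [show |(-3 : ℝ)| = (3 : ℕ) by norm_num, Real.rpow_natCast]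
    exact pow_le_pow_left₀ (zero_le_one.trans hL1) hF.L_le 3
  have htr : ∀ y y' : (geo9Y x).Site, Real.exp (-(q.αF * ((1 - 2 * q.α) * q.δ₀) * (geo9Y x).dist y y')) * ((geo9Y x).len y' ^ 3)⁻¹ ≤
      ((θ.ℓ₆ + 1 : ℕ) : ℝ) ^ 3 * ((geo9Y x).len y ^ 3)⁻¹ := by
    intro y y'
    have hst := scaleTransfer_len_rpow hF (-3) (by norm_num) y y'
    have hy := geo9Y_len_pos x y
    have hy' := geo9Y_len_pos x y'
    have e1 : ((geo9Y x).len y' ^ 3)⁻¹ = (geo9Y x).len y' ^ (-3 : ℝ) := by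
      rw [show (-3 : ℝ) = -((3 : ℕ) : ℝ) by norm_num, Real.rpow_neg hy'.le, Real.rpow_natCast]
    have e2 : ((geo9Y x).len y ^ 3)⁻¹ = (geo9Y x).len y ^ (-3 : ℝ) := by
      rw [show (-3 : ℝ) = -((3 : ℕ) : ℝ) by norm_num, Real.rpow_neg hy.le, Real.rpow_natCast]
    rw [e1, e2]
    exact hst.trans (mul_le_mul_of_nonneg_right hLle (Real.rpow_nonneg hy.le _))
  -- [4] (2.61) row sum at the rate ρ_R
  have hR : ∑ y' : (geo9Y x).Site, Real.exp (-(ρR * (geo9Y x).dist c y')) ≤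
      rowConst261 (geo9Y (d := θ.d₆) (ℓ := θ.ℓ₆) (hd := θ.hd') (hL := θ.hL') (b₀ := θ.b₀) (b₁ := θ.b₁) (Mstar := Mstar)) ρR := by
    exact hrowc x ((le_max_right _ _).trans hMx) c
  obtain ⟨hT, hK'⟩ := hHT x hMM α₀ hα ha U hU hU'
  have hmain := norm_trAdjY_JY_le_of_transposePair_regularAt (R₀ := 1) (H₀ := H x) x.toKIdx (g := geo9Y x)
    (bg9Y (Matrix (Fin N) (Fin N) ℂ) (specialUnitaryUnits (Fin N)) x) (fun U => U)
    (HDY x.toKIdx (parSymY x.toKIdx) (parBY x.toKIdx) (GpY x.toKIdx (parSymY x.toKIdx))) U (bI x) (hbI0 x) (fun c => c)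
    (etaBY_le_len x) hC0 hC1 (hreg x hMM α₀ hα ha U hU hU') hc0 hT hBT hK' c (by positivity) hδT (geo9K_dist_nonneg x.toKIdx) htr hR
  have hw : 0 ≤ ((geo9Y x).len c ^ 3)⁻¹ := inv_nonneg.mpr (pow_nonneg (geo9Y_len_pos x c).le 3)
  calc _ ≤ _ := hmain
    _ = (N * basisBound39 (trBasis N) ^ 2 * (10 ^ 4 * ((θ.d₆ : ℝ) + 1) * cJ) * (((θ.d₆ : ℝ) + 1) * Fintype.card (TrIdx N) * BT) *
          ((((θ.ℓ₆ + 1 : ℕ) : ℝ) ^ 3) *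
            rowConst261 (geo9Y (d := θ.d₆) (ℓ := θ.ℓ₆) (hd := θ.hd') (hL := θ.hL') (b₀ := θ.b₀) (b₁ := θ.b₁) (Mstar := Mstar)) ρR)) *
          ((geo9Y x).M * α₀) * ((geo9Y x).len c ^ 3)⁻¹ := by ring
    _ ≤ tHJ * ((geo9Y x).M * α₀) * ((geo9Y x).len c ^ 3)⁻¹ := mul_le_mul_of_nonneg_right (mul_le_mul_of_nonneg_right htHJ hθ) hw

/-- ★★ **EDITION 30's `hD2sup` AT `𝔯 := resYOfC2 N θ M⋆ 𝔠` WITH THE `(H\*J)` LETTER ELIMINATED**: F6's `hD2sup_of_form_schemas_w` at the weight split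
`w_H = (Lʲη)⁻³`, `w_C` free with `w_C(c)·(Lʲη)_c⁻³ ≦ (Lʲη)_c⁻²`, its binder `hHJ` supplied by `hHJ_of_transpose_schemas`: from [5] (149) (`hC2`), the
transpose-majorant letter `hHT`, regularity at every fine bond `hreg`, the pins `hbI0 ∕ hblk12`, the member facts and two displayed constants.
[cite: Balaban1985BackgroundPropagators, (3.136)–(3.137) pp.422–423, (3.134) p.422, (3.133) p.422, (3.36) p.396, p.398; Balaban1985Averaging, (149) p.40; Balaban1984PropagatorsII, (2.51) p.232, (2.54), (2.60)–(2.61) pp.233–234] -/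
theorem hD2sup_of_transpose_schemas (q : PinPrims) (hq : q.OK) (H : MemberY θ.d₆ θ.ℓ₆ θ.hd' θ.hL' θ.b₀ θ.b₁ Mstar → Prop) (𝔠 : C2Y N θ Mstar)
    (𝔬12 : ∀ x : MemberY θ.d₆ θ.ℓ₆ θ.hd' θ.hL' θ.b₀ θ.b₁ Mstar, B9Thm312Whole.Ops (geo9Y x) (bg9Y (Matrix (Fin N) (Fin N) ℂ) (specialUnitaryUnits (Fin N)) x)
      (XBK (TrIdx N) x.toKIdx) (XBK (TrIdx N) x.toKIdx) (XHK (TrIdx N) x.toKIdx) (XSK (TrIdx N) x.toKIdx))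
    (bI : ∀ x : MemberY θ.d₆ θ.ℓ₆ θ.hd' θ.hL' θ.b₀ θ.b₁ Mstar, FBondY x.toKIdx → IBondY x.toKIdx)
    (hbI0 : ∀ (x : MemberY θ.d₆ θ.ℓ₆ θ.hd' θ.hL' θ.b₀ θ.b₁ Mstar) (f : FBondY x.toKIdx), bI x f = bI x ⟨f.src, 0⟩)
    (hblk12 : ∀ x : MemberY θ.d₆ θ.ℓ₆ θ.hd' θ.hL' θ.b₀ θ.b₁ Mstar, (𝔬12 x).blk = blkBK x.toKIdx (bI x))
    (𝔗 : ∀ x : MemberY θ.d₆ θ.ℓ₆ θ.hd' θ.hL' θ.b₀ θ.b₁ Mstar, (bg9Y (Matrix (Fin N) (Fin N) ℂ) (specialUnitaryUnits (Fin N)) x).Cfg →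
      (XBK (TrIdx N) x.toKIdx → ℝ) →ₗ[ℝ] (XHK (TrIdx N) x.toKIdx → ℝ))
    (wC : ∀ x : MemberY θ.d₆ θ.ℓ₆ θ.hd' θ.hL' θ.b₀ θ.b₁ Mstar, IBondY x.toKIdx → ℝ) (hwC : ∀ x c, 0 ≤ wC x c)
    (hww : ∀ x c, wC x c * ((geo9Y x).len c ^ 3)⁻¹ ≤ ((geo9Y x).len c ^ 2)⁻¹)
    (κC δC cJ BT δT ρR tHJ δ₂ θ₂ M a : ℝ) (hκC : 0 ≤ κC) (hcJ : 0 ≤ cJ) (hBT : 0 ≤ BT) (hρR : 0 < ρR) (hδ₂ : 0 ≤ δ₂) (hM : 0 < M) (ha1 : cJ * a ≤ 1)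
    (hδC : δ₂ + q.αF * ((1 - 2 * q.α) * q.δ₀) + ρR ≤ δC) (hδT : q.αF * ((1 - 2 * q.α) * q.δ₀) + ρR ≤ δT)
    (htHJ : N * basisBound39 (trBasis N) ^ 2 * (10 ^ 4 * ((θ.d₆ : ℝ) + 1) * cJ) * (((θ.d₆ : ℝ) + 1) * Fintype.card (TrIdx N) * BT) *
      ((((θ.ℓ₆ + 1 : ℕ) : ℝ) ^ 3) * rowConst261 (geo9Y (d := θ.d₆) (ℓ := θ.ℓ₆) (hd := θ.hd') (hL := θ.hL') (b₀ := θ.b₀) (b₁ := θ.b₁) (Mstar := Mstar)) ρR) ≤ tHJ)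
    (hθ₂ : (cR39 (trBasis N))⁻¹ * (2 * N * basisBound39 (trBasis N) ^ 2 * κC * tHJ * (((θ.ℓ₆ + 1 : ℕ) : ℝ) ^ 2) *
      rowConst261 (geo9Y (d := θ.d₆) (ℓ := θ.ℓ₆) (hd := θ.hd') (hL := θ.hL') (b₀ := θ.b₀) (b₁ := θ.b₁) (Mstar := Mstar)) ρR) ≤ θ₂)
    (hC2 : ∀ x : MemberY θ.d₆ θ.ℓ₆ θ.hd' θ.hL' θ.b₀ θ.b₁ Mstar, M ≤ (geo9Y x).M → ∀ α₀ : ℝ, 0 < α₀ → (geo9Y x).M * α₀ ≤ a →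
      ∀ U : (bg9Y (Matrix (Fin N) (Fin N) ℂ) (specialUnitaryUnits (Fin N)) x).Cfg,
        (bg9Y (Matrix (Fin N) (Fin N) ℂ) (specialUnitaryUnits (Fin N)) x).Reg335 c35Y α₀ U →
        (bg9Y (Matrix (Fin N) (Fin N) ℂ) (specialUnitaryUnits (Fin N)) x).Reg336 c35Y α₀ U →
          C2FormMaj x.toKIdx (g := geo9Y x) (bI x) (fun c => c) (𝔠 x).form U κC δC (wC x))
    (hHT : ∀ x : MemberY θ.d₆ θ.ℓ₆ θ.hd' θ.hL' θ.b₀ θ.b₁ Mstar, M ≤ (geo9Y x).M → ∀ α₀ : ℝ, 0 < α₀ → (geo9Y x).M * α₀ ≤ a →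
      ∀ U : (bg9Y (Matrix (Fin N) (Fin N) ℂ) (specialUnitaryUnits (Fin N)) x).Cfg,
        (bg9Y (Matrix (Fin N) (Fin N) ℂ) (specialUnitaryUnits (Fin N)) x).Reg335 c35Y α₀ U →
        (bg9Y (Matrix (Fin N) (Fin N) ℂ) (specialUnitaryUnits (Fin N)) x).Reg336 c35Y α₀ U →
          IsTransposePair (HcoK x.toKIdx (trBasis N) (bg9Y (Matrix (Fin N) (Fin N) ℂ) (specialUnitaryUnits (Fin N)) x) (fun U => U)
              (HDY x.toKIdx (parSymY x.toKIdx) (parBY x.toKIdx) (GpY x.toKIdx (parSymY x.toKIdx))) U) (𝔗 x U) ∧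
            HasMajorantHom (g := toB6 (geo9Y x) 1 (H x)) (fun p : XBK (TrIdx N) x.toKIdx => bI x p.1) (fun p : XHK (TrIdx N) x.toKIdx => p.1) (𝔗 x U)
              (fun c y' => BT * Real.exp (-(δT * (geo9Y x).dist c y'))))
    (hreg : ∀ x : MemberY θ.d₆ θ.ℓ₆ θ.hd' θ.hL' θ.b₀ θ.b₁ Mstar, M ≤ (geo9Y x).M → ∀ α₀ : ℝ, 0 < α₀ → (geo9Y x).M * α₀ ≤ a →
      ∀ U : (bg9Y (Matrix (Fin N) (Fin N) ℂ) (specialUnitaryUnits (Fin N)) x).Cfg,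
        (bg9Y (Matrix (Fin N) (Fin N) ℂ) (specialUnitaryUnits (Fin N)) x).Reg335 c35Y α₀ U →
        (bg9Y (Matrix (Fin N) (Fin N) ℂ) (specialUnitaryUnits (Fin N)) x).Reg336 c35Y α₀ U →
          ∀ μ s, RegularAt (shiftsV1 (PV θ.d₆ θ.ℓ₆ x.toKIdx.m x.toKIdx.K θ.hd' θ.hL')) U (etaBY x.toKIdx)
            (cJ * ((geo9Y x).M * α₀)) ((geo9Y x).len (bI x ⟨s, 0⟩)) μ s) :
    ∃ ML : ℝ, ∀ x : MemberY θ.d₆ θ.ℓ₆ θ.hd' θ.hL' θ.b₀ θ.b₁ Mstar, ML ≤ (geo9Y x).M → M ≤ (geo9Y x).M → ∀ α₀ : ℝ, 0 < α₀ → (geo9Y x).M * α₀ ≤ a →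
      ∀ U : (bg9Y (Matrix (Fin N) (Fin N) ℂ) (specialUnitaryUnits (Fin N)) x).Cfg,
        (bg9Y (Matrix (Fin N) (Fin N) ℂ) (specialUnitaryUnits (Fin N)) x).Reg335 c35Y α₀ U →
        (bg9Y (Matrix (Fin N) (Fin N) ℂ) (specialUnitaryUnits (Fin N)) x).Reg336 c35Y α₀ U →
          HasMajorant (g := toB6 (geo9Y x) 1 (H x)) (𝔬12 x).blk
            (D2coK x.toKIdx (trBasis N) (bg9Y (Matrix (Fin N) (Fin N) ℂ) (specialUnitaryUnits (Fin N)) x) (fun U => U) ((resYOfC2 N θ Mstar 𝔠 x).Δ2) U)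
            (fun (a b : (geo9Y x).Site) => θ₂ * ((geo9Y x).M * α₀) * ((geo9Y x).len a ^ 2)⁻¹ * Real.exp (-(δ₂ * (geo9Y x).dist a b))) := by
  obtain ⟨MH, hHJ⟩ := hHJ_of_transpose_schemas q hq H bI hbI0 𝔗 cJ BT δT ρR tHJ M a hcJ hBT hρR hM ha1 hδT htHJ hHT hreg
  -- F6 in the regime `max M MH ≤ M_x`
  have hrc : 0 ≤ rowConst261 (geo9Y (d := θ.d₆) (ℓ := θ.ℓ₆) (hd := θ.hd') (hL := θ.hL') (b₀ := θ.b₀) (b₁ := θ.b₁) (Mstar := Mstar)) ρR :=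
    rowConst261_nonneg _ _
  have htHJ0 : 0 ≤ tHJ := le_trans (by positivity) htHJ
  have hM' : 0 < max M MH := lt_max_of_lt_left hM
  obtain ⟨ML, hsup⟩ := hD2sup_of_form_schemas_w q hq H 𝔠 𝔬12 bI hblk12 wC (fun x c => ((geo9Y x).len c ^ 3)⁻¹) hwC
    (fun x c => inv_nonneg.mpr (pow_nonneg (geo9Y_len_pos x c).le 3)) hww κC δC tHJ ρR δ₂ θ₂ (max M MH) a hκC htHJ0 hρR hδ₂ hM' hδC hθ₂
    (fun x hMx α₀ hα ha U hU hU' => hC2 x ((le_max_left _ _).trans hMx) α₀ hα ha U hU hU')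
    (fun x hMx α₀ hα ha U hU hU' c => hHJ x ((le_max_right _ _).trans hMx) ((le_max_left _ _).trans hMx) α₀ hα ha U hU hU' c)
  exact ⟨max ML MH, fun x hMx hMM α₀ hα ha U hU hU' =>
    hsup x ((le_max_left _ _).trans hMx) (max_le hMM ((le_max_right _ _).trans hMx)) α₀ hα ha U hU hU'⟩

/-- ★★ **EDITION 29's `hD2L2` AT `𝔯 := resYOfC2 N θ M⋆ 𝔠` WITH THE `(H\*J)` LETTER ELIMINATED**: `hD2sup_of_transpose_schemas` + def-Y's reality letters `hC hH`
(F6's `hD2L2_of_form_schemas_w` road: `resYOfC2_Δ2_isSymmTr` + Schur `blockBd_d2coK_of_sup_symm`).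
[cite: Balaban1985BackgroundPropagators, (3.137) p.423, (3.134) p.422, (3.46) p.398, p.391; Balaban1985Averaging, (149) p.40; Balaban1984PropagatorsII, (2.51) p.232] -/
theorem hD2L2_of_transpose_schemas (q : PinPrims) (hq : q.OK) (H : MemberY θ.d₆ θ.ℓ₆ θ.hd' θ.hL' θ.b₀ θ.b₁ Mstar → Prop) (𝔠 : C2Y N θ Mstar)
    (𝔬12 : ∀ x : MemberY θ.d₆ θ.ℓ₆ θ.hd' θ.hL' θ.b₀ θ.b₁ Mstar, B9Thm312Whole.Ops (geo9Y x) (bg9Y (Matrix (Fin N) (Fin N) ℂ) (specialUnitaryUnits (Fin N)) x)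
      (XBK (TrIdx N) x.toKIdx) (XBK (TrIdx N) x.toKIdx) (XHK (TrIdx N) x.toKIdx) (XSK (TrIdx N) x.toKIdx))
    (bI : ∀ x : MemberY θ.d₆ θ.ℓ₆ θ.hd' θ.hL' θ.b₀ θ.b₁ Mstar, FBondY x.toKIdx → IBondY x.toKIdx)
    (hbI0 : ∀ (x : MemberY θ.d₆ θ.ℓ₆ θ.hd' θ.hL' θ.b₀ θ.b₁ Mstar) (f : FBondY x.toKIdx), bI x f = bI x ⟨f.src, 0⟩)
    (hblk12 : ∀ x : MemberY θ.d₆ θ.ℓ₆ θ.hd' θ.hL' θ.b₀ θ.b₁ Mstar, (𝔬12 x).blk = blkBK x.toKIdx (bI x))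
    (𝔗 : ∀ x : MemberY θ.d₆ θ.ℓ₆ θ.hd' θ.hL' θ.b₀ θ.b₁ Mstar, (bg9Y (Matrix (Fin N) (Fin N) ℂ) (specialUnitaryUnits (Fin N)) x).Cfg →
      (XBK (TrIdx N) x.toKIdx → ℝ) →ₗ[ℝ] (XHK (TrIdx N) x.toKIdx → ℝ))
    (wC : ∀ x : MemberY θ.d₆ θ.ℓ₆ θ.hd' θ.hL' θ.b₀ θ.b₁ Mstar, IBondY x.toKIdx → ℝ) (hwC : ∀ x c, 0 ≤ wC x c)
    (hww : ∀ x c, wC x c * ((geo9Y x).len c ^ 3)⁻¹ ≤ ((geo9Y x).len c ^ 2)⁻¹)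
    (κC δC cJ BT δT ρR tHJ δ₂ θ₂ M a : ℝ) (hκC : 0 ≤ κC) (hcJ : 0 ≤ cJ) (hBT : 0 ≤ BT) (hρR : 0 < ρR) (hδ₂ : 0 ≤ δ₂) (hθ₂0 : 0 ≤ θ₂) (hM : 0 < M)
    (ha1 : cJ * a ≤ 1) (hδC : δ₂ + q.αF * ((1 - 2 * q.α) * q.δ₀) + ρR ≤ δC) (hδT : q.αF * ((1 - 2 * q.α) * q.δ₀) + ρR ≤ δT)
    (htHJ : N * basisBound39 (trBasis N) ^ 2 * (10 ^ 4 * ((θ.d₆ : ℝ) + 1) * cJ) * (((θ.d₆ : ℝ) + 1) * Fintype.card (TrIdx N) * BT) *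
      ((((θ.ℓ₆ + 1 : ℕ) : ℝ) ^ 3) * rowConst261 (geo9Y (d := θ.d₆) (ℓ := θ.ℓ₆) (hd := θ.hd') (hL := θ.hL') (b₀ := θ.b₀) (b₁ := θ.b₁) (Mstar := Mstar)) ρR) ≤ tHJ)
    (hθ₂ : (cR39 (trBasis N))⁻¹ * (2 * N * basisBound39 (trBasis N) ^ 2 * κC * tHJ * (((θ.ℓ₆ + 1 : ℕ) : ℝ) ^ 2) *
      rowConst261 (geo9Y (d := θ.d₆) (ℓ := θ.ℓ₆) (hd := θ.hd') (hL := θ.hL') (b₀ := θ.b₀) (b₁ := θ.b₁) (Mstar := Mstar)) ρR) ≤ θ₂)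
    (hC2 : ∀ x : MemberY θ.d₆ θ.ℓ₆ θ.hd' θ.hL' θ.b₀ θ.b₁ Mstar, M ≤ (geo9Y x).M → ∀ α₀ : ℝ, 0 < α₀ → (geo9Y x).M * α₀ ≤ a →
      ∀ U : (bg9Y (Matrix (Fin N) (Fin N) ℂ) (specialUnitaryUnits (Fin N)) x).Cfg,
        (bg9Y (Matrix (Fin N) (Fin N) ℂ) (specialUnitaryUnits (Fin N)) x).Reg335 c35Y α₀ U →
        (bg9Y (Matrix (Fin N) (Fin N) ℂ) (specialUnitaryUnits (Fin N)) x).Reg336 c35Y α₀ U →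
          C2FormMaj x.toKIdx (g := geo9Y x) (bI x) (fun c => c) (𝔠 x).form U κC δC (wC x))
    (hHT : ∀ x : MemberY θ.d₆ θ.ℓ₆ θ.hd' θ.hL' θ.b₀ θ.b₁ Mstar, M ≤ (geo9Y x).M → ∀ α₀ : ℝ, 0 < α₀ → (geo9Y x).M * α₀ ≤ a →
      ∀ U : (bg9Y (Matrix (Fin N) (Fin N) ℂ) (specialUnitaryUnits (Fin N)) x).Cfg,
        (bg9Y (Matrix (Fin N) (Fin N) ℂ) (specialUnitaryUnits (Fin N)) x).Reg335 c35Y α₀ U →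
        (bg9Y (Matrix (Fin N) (Fin N) ℂ) (specialUnitaryUnits (Fin N)) x).Reg336 c35Y α₀ U →
          IsTransposePair (HcoK x.toKIdx (trBasis N) (bg9Y (Matrix (Fin N) (Fin N) ℂ) (specialUnitaryUnits (Fin N)) x) (fun U => U)
              (HDY x.toKIdx (parSymY x.toKIdx) (parBY x.toKIdx) (GpY x.toKIdx (parSymY x.toKIdx))) U) (𝔗 x U) ∧
            HasMajorantHom (g := toB6 (geo9Y x) 1 (H x)) (fun p : XBK (TrIdx N) x.toKIdx => bI x p.1) (fun p : XHK (TrIdx N) x.toKIdx => p.1) (𝔗 x U)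
              (fun c y' => BT * Real.exp (-(δT * (geo9Y x).dist c y'))))
    (hreg : ∀ x : MemberY θ.d₆ θ.ℓ₆ θ.hd' θ.hL' θ.b₀ θ.b₁ Mstar, M ≤ (geo9Y x).M → ∀ α₀ : ℝ, 0 < α₀ → (geo9Y x).M * α₀ ≤ a →
      ∀ U : (bg9Y (Matrix (Fin N) (Fin N) ℂ) (specialUnitaryUnits (Fin N)) x).Cfg,
        (bg9Y (Matrix (Fin N) (Fin N) ℂ) (specialUnitaryUnits (Fin N)) x).Reg335 c35Y α₀ U →
        (bg9Y (Matrix (Fin N) (Fin N) ℂ) (specialUnitaryUnits (Fin N)) x).Reg336 c35Y α₀ U →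
          ∀ μ s, RegularAt (shiftsV1 (PV θ.d₆ θ.ℓ₆ x.toKIdx.m x.toKIdx.K θ.hd' θ.hL')) U (etaBY x.toKIdx)
            (cJ * ((geo9Y x).M * α₀)) ((geo9Y x).len (bI x ⟨s, 0⟩)) μ s)
    (hC : ∀ (x : MemberY θ.d₆ θ.ℓ₆ θ.hd' θ.hL' θ.b₀ θ.b₁ Mstar) (U : CfgY (Matrix (Fin N) (Fin N) ℂ) x.toKIdx), (∀ μ z, U μ z ∈ specialUnitaryUnits (Fin N)) →
      ∀ A A' : FBondY x.toKIdx → Matrix (Fin N) (Fin N) ℂ, (𝔠 x).form U (star A) (star A') = star ((𝔠 x).form U A A'))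
    (hH : ∀ (x : MemberY θ.d₆ θ.ℓ₆ θ.hd' θ.hL' θ.b₀ θ.b₁ Mstar) (U : CfgY (Matrix (Fin N) (Fin N) ℂ) x.toKIdx), (∀ μ z, U μ z ∈ specialUnitaryUnits (Fin N)) →
      ∀ X : IBondY x.toKIdx → Matrix (Fin N) (Fin N) ℂ,
        HDY x.toKIdx (parSymY x.toKIdx) (parBY x.toKIdx) (GpY x.toKIdx (parSymY x.toKIdx)) U (star X) =
          star (HDY x.toKIdx (parSymY x.toKIdx) (parBY x.toKIdx) (GpY x.toKIdx (parSymY x.toKIdx)) U X)) :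
    ∃ ML : ℝ, ∀ x : MemberY θ.d₆ θ.ℓ₆ θ.hd' θ.hL' θ.b₀ θ.b₁ Mstar, ML ≤ (geo9Y x).M → M ≤ (geo9Y x).M → ∀ α₀ : ℝ, 0 < α₀ → (geo9Y x).M * α₀ ≤ a →
      ∀ U : (bg9Y (Matrix (Fin N) (Fin N) ℂ) (specialUnitaryUnits (Fin N)) x).Cfg,
        (bg9Y (Matrix (Fin N) (Fin N) ℂ) (specialUnitaryUnits (Fin N)) x).Reg335 c35Y α₀ U →
        (bg9Y (Matrix (Fin N) (Fin N) ℂ) (specialUnitaryUnits (Fin N)) x).Reg336 c35Y α₀ U →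
          BlockBd (g := toB6 (geo9Y x) 1 (H x)) (𝔬12 x).blk (𝔬12 x).blk
            (D2coK x.toKIdx (trBasis N) (bg9Y (Matrix (Fin N) (Fin N) ℂ) (specialUnitaryUnits (Fin N)) x) (fun U => U) ((resYOfC2 N θ Mstar 𝔠 x).Δ2) U)
            (fun (y y' : (geo9Y x).Site) => θ₂ * ((geo9Y x).M * α₀) * ((geo9Y x).len y)⁻¹ * ((geo9Y x).len y')⁻¹ *
              Real.exp (-(δ₂ * (geo9Y x).dist y y'))) := by
  obtain ⟨MH, hHJ⟩ := hHJ_of_transpose_schemas q hq H bI hbI0 𝔗 cJ BT δT ρR tHJ M a hcJ hBT hρR hM ha1 hδT htHJ hHT hreg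
  have hrc : 0 ≤ rowConst261 (geo9Y (d := θ.d₆) (ℓ := θ.ℓ₆) (hd := θ.hd') (hL := θ.hL') (b₀ := θ.b₀) (b₁ := θ.b₁) (Mstar := Mstar)) ρR :=
    rowConst261_nonneg _ _
  have htHJ0 : 0 ≤ tHJ := le_trans (by positivity) htHJ
  have hM' : 0 < max M MH := lt_max_of_lt_left hM
  obtain ⟨ML, hL2⟩ := hD2L2_of_form_schemas_w q hq H 𝔠 𝔬12 bI hblk12 wC (fun x c => ((geo9Y x).len c ^ 3)⁻¹) hwC
    (fun x c => inv_nonneg.mpr (pow_nonneg (geo9Y_len_pos x c).le 3)) hww κC δC tHJ ρR δ₂ θ₂ (max M MH) a hκC htHJ0 hρR hδ₂ hθ₂0 hM' hδC hθ₂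
    (fun x hMx α₀ hα ha U hU hU' => hC2 x ((le_max_left _ _).trans hMx) α₀ hα ha U hU hU')
    (fun x hMx α₀ hα ha U hU hU' c => hHJ x ((le_max_right _ _).trans hMx) ((le_max_left _ _).trans hMx) α₀ hα ha U hU hU' c) hC hH
  exact ⟨max ML MH, fun x hMx hMM α₀ hα ha U hU hU' =>
    hL2 x ((le_max_left _ _).trans hMx) (max_le hMM ((le_max_right _ _).trans hMx)) α₀ hα ha U hU hU'⟩

end Summit.QuantumFields.YangMills.BalabanUVNodes.N06HstarJAtPinsPhys

end
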